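import Mathlib.Algebra.Polynomial.Roots
import Literature.LinearAlgebra.Matrix.RankMinors
import Literature.LinearAlgebra.Matrix.PolynomialMinorsDegree
import HarnessLib

/-!
# Rank loci of a one-parameter polynomial family of matrices

Topic `Literature/LinearAlgebra/Matrix`. Let `F` be a field and `P ∈ Mat_{m×n}(F[X])` a matrix with
polynomial entries; write `P(b) := P.map (eval b)` for its specialisation at `b : F`.
**Lower semicontinuity of rank in an algebraic family** [folklore; e.g. Harris,
*Algebraic Geometry: A First Course*, Lecture 9 (rank conditions `rank ≤ k` are closed)]:

* `setOf_rank_map_eval_lt_finite` — if `s ≤ rank P(a)` for ONE `a`, then `{b | rank P(b) < s}` is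
  finite: it lies in the zero set of the non-zero polynomial `det P[r,c] ∈ F[X]` for any `s × s`
  minor non-singular at `a` (`exists_minor_controls_rank`).
* `ncard_setOf_rank_map_eval_lt_le` — if moreover every entry of `P` has degree `≤ D`, the number of
  exceptional parameters is at most `s · D` (the degree of that minor).
* `setOf_lt_corank_map_eval_finite` — the same statement for the corank `|n| − rank`.
* `rank_map_eval_le_of_forall_mem`, `setOf_rank_map_eval_ne_finite` — conversely, `rank P(b) ≤ s`
  at more than `(s+1)·D` parameters forces `rank P(b) ≤ s` at ALL parameters (all `(s+1)`-minors
  vanish identically), so together with one lower bound the generic rank is certified by finitely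
  many evaluations.

Everything is PROVED from `Literature.LinearAlgebra.Matrix.le_rank_iff_exists_det_submatrix_ne_zero`
(rank via minors) and `Polynomial.finite_setOf_isRoot`; no definitions, no named facts.

Use (Hodge-locus census, cell `pub-hlocus`, COMPONENTS.md 'UNIFORMITY IN λ'): the truncated period
ideal of the class `[P] + λ[P̌]` is the column span of a matrix whose entries are affine in `λ`, so its
colength `ℓ_N(λ) = dim A_N − rank` can only exceed its value at one certified `λ₀` on a finite,
explicitly bounded set of `λ`; combined with
`Literature.RingTheory.Length.pow_le_sup_pow_succ_of_finrank_le` (file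
`Literature/RingTheory/Length/TruncatedColengthCriterion.lean`) this replaces the analytic
semicontinuity step of that argument by an algebraic one with a computable exceptional set.

## References

* [Harris1992] J. Harris, Algebraic Geometry: A First Course, GTM 133, Springer 1992, Lecture 9.
-/

namespace Literature.LinearAlgebra.Matrix

open _root_.Matrix _root_.Polynomial

variable {F : Type*} [Field F] {m n : Type*} [Fintype m] [Fintype n]

omit [Fintype m] [Fintype n] in
/-- Minors commute with specialisation: `det (P(b)[r,c]) = (det P[r,c])(b)`. [folklore] -/
theorem det_submatrix_map_eval {ι : Type*} [Fintype ι] [DecidableEq ι] (P : Matrix m n F[X])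
    (r : ι → m) (c : ι → n) (b : F) :
    ((P.map (eval b)).submatrix r c).det = eval b (P.submatrix r c).det := by
  have h : (P.map (eval b)).submatrix r c = (evalRingHom b).mapMatrix (P.submatrix r c) := rfl
  rw [h, ← RingHom.map_det]
  rfl

/-- **A minor non-singular at one parameter controls the rank at all but finitely many parameters.**
If `s ≤ rank P(a)` then there is a non-zero polynomial `q` (an `s × s` minor of `P`) with
`q(a) ≠ 0` such that `s ≤ rank P(b)` whenever `q(b) ≠ 0`. [folklore] -/
theorem exists_minor_controls_rank (P : Matrix m n F[X]) {s : ℕ} {a : F}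
    (ha : s ≤ (P.map (eval a)).rank) :
    ∃ (r : Fin s → m) (c : Fin s → n),
      (P.submatrix r c).det ≠ 0 ∧ eval a (P.submatrix r c).det ≠ 0 ∧
        ∀ b : F, eval b (P.submatrix r c).det ≠ 0 → s ≤ (P.map (eval b)).rank := by
  classical
  obtain ⟨r, c, hne⟩ := (le_rank_iff_exists_det_submatrix_ne_zero _).1 ha
  rw [det_submatrix_map_eval] at hne
  refine ⟨r, c, ?_, hne, ?_⟩
  · intro h
    exact hne (by rw [h, eval_zero])
  · intro b hb
    refine (le_rank_iff_exists_det_submatrix_ne_zero _).2 ⟨r, c, ?_⟩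
    rwa [det_submatrix_map_eval]

/-- **Lower semicontinuity of rank, finiteness form.** If `s ≤ rank P(a)` for one parameter `a`,
then the set of parameters `b` with `rank P(b) < s` is finite. [folklore] -/
theorem setOf_rank_map_eval_lt_finite (P : Matrix m n F[X]) {s : ℕ} {a : F}
    (ha : s ≤ (P.map (eval a)).rank) :
    {b : F | (P.map (eval b)).rank < s}.Finite := by
  classical
  obtain ⟨r, c, hq, -, hrank⟩ := exists_minor_controls_rank P ha
  refine (Polynomial.finite_setOf_isRoot hq).subset ?_
  intro b hb
  by_contra hroot
  exact (not_le.2 hb) (hrank b hroot)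

/-- The exceptional set lies in the root set of the controlling minor. [folklore] -/
theorem setOf_rank_map_eval_lt_subset_roots [DecidableEq F] (P : Matrix m n F[X]) {s : ℕ} {a : F}
    (ha : s ≤ (P.map (eval a)).rank) :
    ∃ q : F[X], q ≠ 0 ∧ (∃ (r : Fin s → m) (c : Fin s → n), q = (P.submatrix r c).det) ∧
      {b : F | (P.map (eval b)).rank < s} ⊆ (q.roots.toFinset : Set F) := by
  classical
  obtain ⟨r, c, hq, -, hrank⟩ := exists_minor_controls_rank P ha
  refine ⟨(P.submatrix r c).det, hq, ⟨r, c, rfl⟩, ?_⟩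
  intro b hb
  simp only [Set.mem_setOf_eq] at hb
  simp only [Finset.mem_coe, Multiset.mem_toFinset, mem_roots hq, IsRoot.def]
  by_contra hroot
  exact (not_le.2 hb) (hrank b hroot)

/-- **Quantitative form.** If every entry of `P` has degree `≤ D` and `s ≤ rank P(a)` for one `a`,
then at most `s · D` parameters `b` have `rank P(b) < s`. [folklore] -/
theorem ncard_setOf_rank_map_eval_lt_le [DecidableEq F] (P : Matrix m n F[X]) {s D : ℕ} {a : F}
    (hD : ∀ i j, (P i j).natDegree ≤ D) (ha : s ≤ (P.map (eval a)).rank) :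
    {b : F | (P.map (eval b)).rank < s}.ncard ≤ s * D := by
  classical
  obtain ⟨q, hq, ⟨r, c, rfl⟩, hsub⟩ := setOf_rank_map_eval_lt_subset_roots P ha
  have hdeg : ((P.submatrix r c).det).natDegree ≤ s * D := by
    have := natDegree_det_le_of_forall_le (P.submatrix r c) (D := D) (fun i j => hD (r i) (c j))
    simpa using this
  calc {b : F | (P.map (eval b)).rank < s}.ncard
      ≤ ((P.submatrix r c).det.roots.toFinset : Set F).ncard :=
        Set.ncard_le_ncard hsub (Finset.finite_toSet _)
    _ = (P.submatrix r c).det.roots.toFinset.card := Set.ncard_coe_finset _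
    _ ≤ Multiset.card (P.submatrix r c).det.roots := Multiset.toFinset_card_le _
    _ ≤ ((P.submatrix r c).det).natDegree := card_roots' _
    _ ≤ s * D := hdeg

/-- **Corank form.** If the corank `|n| − rank P(a)` is `≤ ℓ` at one parameter `a`, then it is `≤ ℓ`
at all but finitely many parameters. [folklore] -/
theorem setOf_lt_corank_map_eval_finite (P : Matrix m n F[X]) {ℓ : ℕ} {a : F}
    (ha : Fintype.card n - (P.map (eval a)).rank ≤ ℓ) :
    {b : F | ℓ < Fintype.card n - (P.map (eval b)).rank}.Finite := by
  have hle : ∀ b : F, (P.map (eval b)).rank ≤ Fintype.card n := fun b => rank_le_card_width _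
  refine (setOf_rank_map_eval_lt_finite P (s := Fintype.card n - ℓ) (a := a) ?_).subset ?_
  · have := hle a
    omega
  · intro b hb
    simp only [Set.mem_setOf_eq] at hb ⊢
    have := hle b
    omega

/-- **Finitely many evaluations certify a rank bound for ALL parameters.** If every entry of `P`
has degree `≤ D` and `rank P(b) ≤ s` for every `b` in a finite set of MORE than `(s+1)·D`
parameters, then `rank P(b) ≤ s` for every parameter `b`: each `(s+1) × (s+1)` minor of `P` has
degree `≤ (s+1)·D` and vanishes on that set, hence is the zero polynomial. [folklore] -/
theorem rank_map_eval_le_of_forall_mem (P : Matrix m n F[X]) {s D : ℕ}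
    (hD : ∀ i j, (P i j).natDegree ≤ D) (T : Finset F) (hcard : (s + 1) * D < T.card)
    (hT : ∀ b ∈ T, (P.map (eval b)).rank ≤ s) (b : F) : (P.map (eval b)).rank ≤ s := by
  classical
  refine rank_le_of_det_submatrix_eq_zero _ (fun r c => ?_)
  have hq : (P.submatrix r c).det = 0 := by
    refine Polynomial.eq_zero_of_natDegree_lt_card_of_eval_eq_zero' _ T (fun t ht => ?_) ?_
    · rw [← det_submatrix_map_eval]
      exact (rank_le_iff_det_submatrix_eq_zero _).1 (hT t ht) r c
    · have := natDegree_det_le_of_forall_le (P.submatrix r c) (D := D)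
        (fun i j => hD (r i) (c j))
      simp only [Fintype.card_fin] at this
      omega
  rw [det_submatrix_map_eval, hq, eval_zero]

/-- **Certificate for the generic rank.** With entries of degree `≤ D`: if `s ≤ rank P(a)` at ONE
parameter and `rank P(b) ≤ s` at more than `(s+1)·D` parameters, then `rank P(b) = s` for all but
finitely many `b` (and `≤ s` everywhere, `rank_map_eval_le_of_forall_mem`). This is the finite
protocol by which a 'generic value' of a rank (or corank, Hilbert–Samuel sample) depending
polynomially on one parameter is certified by single-parameter evaluations. [folklore] -/
theorem setOf_rank_map_eval_ne_finite (P : Matrix m n F[X]) {s D : ℕ}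
    (hD : ∀ i j, (P i j).natDegree ≤ D) {a : F} (ha : s ≤ (P.map (eval a)).rank)
    (T : Finset F) (hcard : (s + 1) * D < T.card) (hT : ∀ b ∈ T, (P.map (eval b)).rank ≤ s) :
    {b : F | (P.map (eval b)).rank ≠ s}.Finite := by
  have hle := rank_map_eval_le_of_forall_mem P hD T hcard hT
  refine (setOf_rank_map_eval_lt_finite P ha).subset ?_
  intro b hb
  simp only [Set.mem_setOf_eq] at hb ⊢
  exact lt_of_le_of_ne (hle b) hb

end Literature.LinearAlgebra.Matrix
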